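import Mathlib
import Summits.AtomisticToContinuum.Crystallization.Theorems.NashClassCertificatesNashNearFieldStubMinimalityOfTubeCoercivity

/-!
# Crux `NashNearField` (stmt-AtomisticToContinuum-16827), line `birth`: P-min at threshold `53/50`

Follow-up to `stub_minimalityOfTubeCoercivity` (threshold `26/25`): the nearest-neighbour indicator
`[ |x_i − x_j| ≤ 26/25 ]` silently drops first-shell bonds of good regions in `(1.04, 1.05]` (good nn
distances reach `1.05 a` at the corner `a = 1`), while `53/50` is free because `53/50 + 2·(1/50) = 11/10`
is exactly the (inclusive) threshold of the tube-coercivity premise.  We factor the argument through the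
threshold-parametric lemma `minimality_of_tubeCoercivity_thr θ (hθ : θ + 2/50 ≤ 11/10)` (same proof as the
landed P-min: `f(t) = E(x + t v)` has `f′(0) = 0` by force balance and `f″ ≥ κ₀ S_θ` by the premise at
`x + t v`, then `Literature.Analysis.Calculus.sub_ge_half_of_deriv2_ge`), reusing the per-bond calculus and the
pair-sum reindexing of `…StubMinimalityOfTubeCoercivity` (`pmin_hasDerivAt_bond`, `pmin_hasDerivAt_bond'`,
`pmin_sum_Ioi_eq_half`, `pmin_sum_inner_eq`, `pmin_profile_eq_deriv_div`), and record the registered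
sub-goal `stub_minimalityOfTubeCoercivity53` (`θ = 53/50`).  All `[folklore]`; a `--supports` piece, nothing
here closes an item.
-/

noncomputable section

namespace Summit.AtomisticToContinuum.Crystallization.Theorems.NashClassCertificatesNashNearField

open scoped BigOperators RealInnerProductSpace
open Literature.MathematicalPhysics.StatisticalMechanics Literature.Geometry.DiscreteGeometry
open Summit.AtomisticToContinuum.Crystallization.Theorems.PhononStabilityNegative
  (Hess₀ Hess₀_neg_left Hess₀_neg_right)

/-- **P-min with a threshold parameter.**  If the Lennard-Jones force-constant form is tube-coercive on good
regions (the premise, verbatim `stub_tubeCoercivity`, nn threshold `11/10`), then for every `θ` with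
`θ + 2/50 ≤ 11/10`, every force-balanced `x` and every tube-preserving perturbation `v` (`‖v_i‖ ≤ 1/50`)
supported in the good region, `(κ₀/2) Σ_i Σ_{j≠i} [ |x_i − x_j| ≤ θ ] ‖v_i − v_j‖² ≤ E(x+v) − E(x)`.
One-variable convexity of `t ↦ E(x + t v)` at its critical point `0`. [folklore] -/
theorem minimality_of_tubeCoercivity_thr (θ : ℝ) (hθ : θ + 2 / 50 ≤ 11 / 10) :
    (∃ κ : ℝ, 0 < κ ∧ ∀ (N : ℕ) (x : Fin N → EuclideanSpace ℝ (Fin 3)), (∀ i j : Fin N, i ≠ j → 1 / 3 ≤ dist (x i) (x j)) →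
      ∀ Ω' : Finset (Fin N),
        (∀ i ∈ Ω', ∀ j : Fin N, dist (x j) (x i) ≤ 4 → IsTwoShellGood (1 / 20) (47 / 50) 1 x j) →
        ∀ u : Fin N → EuclideanSpace ℝ (Fin 3), (∀ i, i ∉ Ω' → u i = 0) →
          κ * (∑ i, ∑ j ∈ Finset.univ.erase i, (if dist (x i) (x j) ≤ 11 / 10 then ‖u i - u j‖ ^ 2 else 0)) ≤
            (1 / 2 : ℝ) * ∑ i, ∑ j ∈ Finset.univ.erase i, (fun (e w : EuclideanSpace ℝ (Fin 3)) => deriv (deriv lennardJones) ‖e‖ * (inner ℝ e w / ‖e‖) ^ 2 + deriv lennardJones ‖e‖ / ‖e‖ * (‖w‖ ^ 2 - (inner ℝ e w / ‖e‖) ^ 2)) (x i - x j) (u i - u j)) →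
    ∃ κ : ℝ, 0 < κ ∧ ∀ (N : ℕ) (x v : Fin N → EuclideanSpace ℝ (Fin 3)) (Ω' : Finset (Fin N)),
      (∀ i : Fin N, ∑ j ∈ Finset.univ.erase i, (deriv lennardJones (dist (x i) (x j)) / dist (x i) (x j)) • (x i - x j) = 0) →
      (∀ i : Fin N, i ∉ Ω' → v i = 0) →
      (∀ t : ℝ, t ∈ Set.Icc (0 : ℝ) 1 →
        (∀ i j : Fin N, i ≠ j → 1 / 3 ≤ dist (x i + t • v i) (x j + t • v j)) ∧
        (∀ i ∈ Ω', ∀ j : Fin N, dist (x j + t • v j) (x i + t • v i) ≤ 4 →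
          IsTwoShellGood (1 / 20) (47 / 50) 1 (fun k => x k + t • v k) j)) →
      (∀ i : Fin N, ‖v i‖ ≤ 1 / 50) →
      κ * (∑ i, ∑ j ∈ Finset.univ.erase i, (if dist (x i) (x j) ≤ θ then ‖v i - v j‖ ^ 2 else 0)) ≤
        interactionEnergy lennardJones (fun k => x k + v k) - interactionEnergy lennardJones x := by
  rintro ⟨κ₀, hκ₀, hTC⟩
  refine ⟨κ₀ / 2, by positivity, ?_⟩
  intro N x v Ω' hFB hsupp htube hsmall
  set S : ℝ := ∑ i, ∑ j ∈ Finset.univ.erase i,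
    (if dist (x i) (x j) ≤ θ then ‖v i - v j‖ ^ 2 else 0) with hS
  -- bond vectors along the segment never vanish
  have hseg : ∀ i j : Fin N, ∀ t : ℝ, x i + t • v i - (x j + t • v j) = x i - x j + t • (v i - v j) := by
    intro i j t
    rw [smul_sub]
    abel
  have hne : ∀ t ∈ Set.Icc (0 : ℝ) 1, ∀ i j : Fin N, i ≠ j → x i - x j + t • (v i - v j) ≠ 0 := by
    intro t ht i j hij h0
    have h13 := (htube t ht).1 i j hij
    rw [dist_eq_norm, hseg, h0, norm_zero] at h13
    norm_num at h13
  -- the energy along the segment and its first two derivatives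
  set f : ℝ → ℝ := fun t => interactionEnergy lennardJones (fun k => x k + t • v k) with hf_def
  set f' : ℝ → ℝ := fun t => ∑ i, ∑ j ∈ Finset.Ioi i,
    (-((‖x i - x j + t • (v i - v j)‖ ^ 2)⁻¹) ^ 7 + ((‖x i - x j + t • (v i - v j)‖ ^ 2)⁻¹) ^ 4) *
      ⟪x i - x j + t • (v i - v j), v i - v j⟫ with hf'_def
  set f'' : ℝ → ℝ := fun t => ∑ i, ∑ j ∈ Finset.Ioi i,
    Hess₀ (x i - x j + t • (v i - v j)) (v i - v j) with hf''_def
  have hfeq : f = fun t => ∑ i, ∑ j ∈ Finset.Ioi i, lennardJones ‖x i - x j + t • (v i - v j)‖ := by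
    funext t
    simp only [hf_def, interactionEnergy, dist_eq_norm, hseg]
  have hf : ∀ t ∈ Set.Icc (0 : ℝ) 1, HasDerivAt f (f' t) t := by
    intro t ht
    rw [hfeq, hf'_def]
    exact HasDerivAt.fun_sum fun i _ => HasDerivAt.fun_sum fun j hj =>
      pmin_hasDerivAt_bond (x i - x j) (v i - v j) (hne t ht i j (Finset.mem_Ioi.1 hj).ne)
  have hf' : ∀ t ∈ Set.Icc (0 : ℝ) 1, HasDerivAt f' (f'' t) t := by
    intro t ht
    rw [hf'_def, hf''_def]
    exact HasDerivAt.fun_sum fun i _ => HasDerivAt.fun_sum fun j hj =>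
      pmin_hasDerivAt_bond' (x i - x j) (v i - v j) (hne t ht i j (Finset.mem_Ioi.1 hj).ne)
  -- `f′(0) = 0` : force balance
  have hx0 : ∀ i j : Fin N, i ≠ j → x i - x j ≠ 0 := by
    intro i j hij
    simpa using hne 0 (Set.left_mem_Icc.2 zero_le_one) i j hij
  have h0 : f' 0 = 0 := by
    rw [hf'_def]
    simp only [zero_smul, add_zero]
    rw [pmin_sum_Ioi_eq_half (fun i j => (-((‖x i - x j‖ ^ 2)⁻¹) ^ 7 + ((‖x i - x j‖ ^ 2)⁻¹) ^ 4) *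
      ⟪x i - x j, v i - v j⟫) (fun i j => by rw [← neg_sub (x i) (x j), ← neg_sub (v i) (v j), inner_neg_neg, norm_neg])]
    rw [pmin_sum_inner_eq x v (fun i j => -((‖x i - x j‖ ^ 2)⁻¹) ^ 7 + ((‖x i - x j‖ ^ 2)⁻¹) ^ 4)
      (fun i j => by rw [← neg_sub (x i) (x j), norm_neg])]
    have hF : ∀ i : Fin N, ∑ j ∈ Finset.univ.erase i,
        (-((‖x i - x j‖ ^ 2)⁻¹) ^ 7 + ((‖x i - x j‖ ^ 2)⁻¹) ^ 4) • (x i - x j) = 0 := by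
      intro i
      rw [← hFB i]
      refine Finset.sum_congr rfl fun j hj => ?_
      rw [pmin_profile_eq_deriv_div (norm_ne_zero_iff.2 (hx0 i j (Finset.ne_of_mem_erase hj).symm)),
        dist_eq_norm]
    beta_reduce
    simp only [hF, inner_zero_left, Finset.sum_const_zero, mul_zero]
  -- `f″(t) ≥ κ₀ S` : tube coercivity at the configuration `x + t v`
  have hm : ∀ t ∈ Set.Icc (0 : ℝ) 1, κ₀ * S ≤ f'' t := by
    intro t ht
    have hTC' := hTC N (fun k => x k + t • v k) (htube t ht).1 Ω' (htube t ht).2 v hsupp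
    -- the left-hand side dominates `S` (`θ + 2/50 ≤ 11/10`)
    have hLHS : S ≤ ∑ i, ∑ j ∈ Finset.univ.erase i,
        (if dist (x i + t • v i) (x j + t • v j) ≤ 11 / 10 then ‖v i - v j‖ ^ 2 else 0) := by
      rw [hS]
      refine Finset.sum_le_sum fun i _ => Finset.sum_le_sum fun j _ => ?_
      have htv : ∀ k : Fin N, ‖t • v k‖ ≤ 1 / 50 := by
        intro k
        rw [norm_smul, Real.norm_eq_abs, abs_of_nonneg ht.1]
        calc t * ‖v k‖ ≤ 1 * ‖v k‖ := mul_le_mul_of_nonneg_right ht.2 (norm_nonneg _)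
          _ ≤ 1 / 50 := by rw [one_mul]; exact hsmall k
      have hdist : dist (x i + t • v i) (x j + t • v j) ≤ dist (x i) (x j) + (1 / 50 + 1 / 50) :=
        calc dist (x i + t • v i) (x j + t • v j) ≤ dist (x i) (x j) + dist (t • v i) (t • v j) :=
              dist_add_add_le _ _ _ _
          _ ≤ dist (x i) (x j) + (‖t • v i‖ + ‖t • v j‖) := by
              gcongr; exact dist_le_norm_add_norm _ _
          _ ≤ dist (x i) (x j) + (1 / 50 + 1 / 50) := by gcongr <;> exact htv _
      split_ifs with h1 h2
      · exact le_rfl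
      · exfalso; apply h2; linarith
      · positivity
      · exact le_rfl
    -- the right-hand side is `f″(t)`
    have hRHS : (1 / 2 : ℝ) * ∑ i, ∑ j ∈ Finset.univ.erase i,
        Hess₀ (x i + t • v i - (x j + t • v j)) (v i - v j) = f'' t := by
      rw [hf''_def]
      dsimp only
      rw [pmin_sum_Ioi_eq_half (fun i j => Hess₀ (x i - x j + t • (v i - v j)) (v i - v j)) (fun i j => by
        rw [← Hess₀_neg_left, ← Hess₀_neg_right, neg_sub, smul_sub, smul_sub]
        congr 1; abel)]
      simp only [hseg]
    calc κ₀ * S ≤ κ₀ * ∑ i, ∑ j ∈ Finset.univ.erase i,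
          (if dist (x i + t • v i) (x j + t • v j) ≤ 11 / 10 then ‖v i - v j‖ ^ 2 else 0) :=
          mul_le_mul_of_nonneg_left hLHS hκ₀.le
      _ ≤ (1 / 2 : ℝ) * ∑ i, ∑ j ∈ Finset.univ.erase i,
          Hess₀ (x i + t • v i - (x j + t • v j)) (v i - v j) := hTC'
      _ = f'' t := hRHS
  -- the one-variable gap lemma
  have hgap : κ₀ * S / 2 ≤ f 1 - f 0 :=
    Literature.Analysis.Calculus.sub_ge_half_of_deriv2_ge hf hf' h0 hm
  have hf1 : f 1 = interactionEnergy lennardJones (fun k => x k + v k) := by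
    simp [hf_def]
  have hf0 : f 0 = interactionEnergy lennardJones x := by
    simp [hf_def]
  rw [hf1, hf0] at hgap
  linarith

/-- **Registered sub-goal `stub_minimalityOfTubeCoercivity53` (P-min, threshold `53/50`)**: tube
coercivity of the Lennard-Jones force-constant form on good regions (the premise, verbatim
`stub_tubeCoercivity`) and force balance give the quadratic gap
`κ Σ_i Σ_{j≠i} [r_ij ≤ 53/50] ‖v_i − v_j‖² ≤ E(x+v) − E(x)` against tube-preserving perturbations supported
in the good region (`53/50 + 2/50 = 11/10`: no first-shell bond of a good region is dropped).
`minimality_of_tubeCoercivity_thr (53/50)`. [folklore] -/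
theorem stub_minimalityOfTubeCoercivity53 :
    (∃ κ : ℝ, 0 < κ ∧ ∀ (N : ℕ) (x : Fin N → EuclideanSpace ℝ (Fin 3)), (∀ i j : Fin N, i ≠ j → 1 / 3 ≤ dist (x i) (x j)) →
      ∀ Ω' : Finset (Fin N),
        (∀ i ∈ Ω', ∀ j : Fin N, dist (x j) (x i) ≤ 4 → IsTwoShellGood (1 / 20) (47 / 50) 1 x j) →
        ∀ u : Fin N → EuclideanSpace ℝ (Fin 3), (∀ i, i ∉ Ω' → u i = 0) →
          κ * (∑ i, ∑ j ∈ Finset.univ.erase i, (if dist (x i) (x j) ≤ 11 / 10 then ‖u i - u j‖ ^ 2 else 0)) ≤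
            (1 / 2 : ℝ) * ∑ i, ∑ j ∈ Finset.univ.erase i, (fun (e w : EuclideanSpace ℝ (Fin 3)) => deriv (deriv lennardJones) ‖e‖ * (inner ℝ e w / ‖e‖) ^ 2 + deriv lennardJones ‖e‖ / ‖e‖ * (‖w‖ ^ 2 - (inner ℝ e w / ‖e‖) ^ 2)) (x i - x j) (u i - u j)) →
    ∃ κ : ℝ, 0 < κ ∧ ∀ (N : ℕ) (x v : Fin N → EuclideanSpace ℝ (Fin 3)) (Ω' : Finset (Fin N)),
      (∀ i : Fin N, ∑ j ∈ Finset.univ.erase i, (deriv lennardJones (dist (x i) (x j)) / dist (x i) (x j)) • (x i - x j) = 0) →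
      (∀ i : Fin N, i ∉ Ω' → v i = 0) →
      (∀ t : ℝ, t ∈ Set.Icc (0 : ℝ) 1 →
        (∀ i j : Fin N, i ≠ j → 1 / 3 ≤ dist (x i + t • v i) (x j + t • v j)) ∧
        (∀ i ∈ Ω', ∀ j : Fin N, dist (x j + t • v j) (x i + t • v i) ≤ 4 →
          IsTwoShellGood (1 / 20) (47 / 50) 1 (fun k => x k + t • v k) j)) →
      (∀ i : Fin N, ‖v i‖ ≤ 1 / 50) →
      κ * (∑ i, ∑ j ∈ Finset.univ.erase i, (if dist (x i) (x j) ≤ 53 / 50 then ‖v i - v j‖ ^ 2 else 0)) ≤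
        interactionEnergy lennardJones (fun k => x k + v k) - interactionEnergy lennardJones x :=
  minimality_of_tubeCoercivity_thr (53 / 50) (by norm_num)

end Summit.AtomisticToContinuum.Crystallization.Theorems.NashClassCertificatesNashNearField

end
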